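import Summits.QuantumFields.BalabanUV.T4Continuum.Support.VariationalCovariantAssemblySqrt
import Summits.QuantumFields.BalabanUV.T4Continuum.Support.VariationalCovariantUpperSqrt
import Summits.QuantumFields.BalabanUV.T4Continuum.Support.VariationalCovariantUpperBoundRel
import Summits.QuantumFields.BalabanUV.T4Continuum.Support.VariationalCovariantOneStepPhys
import Summits.QuantumFields.BalabanUV.T4Continuum.Support.VariationalCovariantRegularityRho

/-!
# T⁴ programme, spine node NE2 (U1a), lane P2 — THE SCALAR COVARIANT CANONICAL PAIR, CLOSED, WITH UB⁺ RELATIVE TO A REFERENCE TRANSPORT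
# (repair R2 of the located finding N-ne2p2g11-2: the constraint's transports `T` arbitrary — e.g. NESTED composites as COMP⁺ requires —,
# leaf UB⁺ taken from a reference transport `T₀` with thin in-block defect `w` and relative phase `‖T·conj T₀ − 1‖ ≤ γ < 1`)
# (road owner `b2b-balaban-t4-ne2-p2` gen 11; `t4/skeletons/NE2-t4-ne2-p2.md` v0.11 §2.D-bis; journal CLAIMS.log l.≈10594)

This file is leaf-09 gen 3's `VariationalCovariantScalarPairClosed.scalar_pair_closed` (p213521) LETTER FOR LETTER with ONE supplier changed:
`hUBc0` comes from `VariationalCovariantUpperBoundRel.exists_ub_scalarPair_rel_eff` (this seat) instead of leaf-04 gen 2's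
`VariationalCovariantUpperBound.exists_ub_scalarPair`.  Extra DATA binders: the reference transport `T₀` (unit modulus), ITS in-block defect
`w`, the relative phase bound `γ < 1`, and a number `w′` with `(4 + n w)/(1 − γ) − 1 ≤ n·w′`; the conclusion is p213521's `let` telescope
VERBATIM at `w := w′` — so the road owner's END (`VariationalCovariantEnd.towerLimitRate_of_closedBrackets`, p213959) applies unchanged with the
CLASS bound read on `w′` (`n·w′ ≤ (4 + c_w)/(1−γ) − 1`).  WHY: along a COMP⁺ tower the transports are nested composites, whose own in-block
defect is `Θ(α)` (not `O(α/n)`), so p213521's `hw` cannot be fed with a k-uniform `n·w`; the reference (straight taxi) has `n·w ≤ (d−1)·n²a`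
(leaf-04 gen 2's `inBlock_defect_taxiT_le`) and the nested-vs-straight relative phase is a k-uniform `O(d·α)` (small field).

HONEST FRAMING (T4-DAG p. 1).  Rung (B)+1 only — NOT infinite volume, NOT a mass gap, NOT Clay.  NE2 is NOT IN PRINT and NOT proved here.
MODEL LEVEL exactly as p213521 (phases, transports, frames, defects = DATA; U(1) charged scalar; global small field); the bound `γ` for Bałaban's
contours is a separate geometric leaf, not claimed.  COMPOSITION of tree theorems, [folklore]; nothing printed is a hypothesis; no `def … : Prop`;
no `sorry`; axioms standard.  HONEST DEPENDENCY (cell, verbatim): continuum YM on T⁴ ⇐ BetaPertH ∧ nine spine estimates (0/9 proved);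
BetaPertH ⇐ (D1) ∧ (D4) ∧ CAP+tail; G-an2-4 gates asym, D1 and NE2/3/4.
-/

noncomputable section

namespace Summit.QuantumFields.BalabanUV.T4Continuum.VariationalCovariantScalarPairClosedRel

open Finset
open Literature.MathematicalPhysics.QuantumFieldTheory.Balaban1983to89
open Literature.MathematicalPhysics.QuantumFieldTheory.Balaban1983to89.B5Prop11Plancherel (Tor fine unitVec)
open Literature.MathematicalPhysics.QuantumFieldTheory.Balaban1983to89.B5Prop11Lower (nsq nsq_nonneg)
open Literature.MathematicalPhysics.QuantumFieldTheory.Balaban1983to89.B5Block118 (bpt)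
open Summit.QuantumFields.BalabanUV.T4Continuum.VariationalTransfer (blockSpin)
open Summit.QuantumFields.BalabanUV.T4Continuum.VariationalCovariantFederbush (cD dirU Qc mis)
open Summit.QuantumFields.BalabanUV.T4Continuum.VariationalCovariantScalarPair
open Summit.QuantumFields.BalabanUV.T4Continuum.VariationalCovariantAssemblySqrt (scalar_pair_bracket_sqrt)
open Summit.QuantumFields.BalabanUV.T4Continuum.VariationalCovariantUpperSqrt (fine_ub_of_coarse_sqrt)
open Summit.QuantumFields.BalabanUV.T4Continuum.VariationalCovariantUpperBoundRel (exists_ub_scalarPair_rel_eff)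
open Summit.QuantumFields.BalabanUV.T4Continuum.VariationalCovariantOneStepPhys (blockSpin_Q1_le)
open Summit.QuantumFields.BalabanUV.T4Continuum.VariationalCovariantInterpolant (rho rho_nonneg)
open Summit.QuantumFields.BalabanUV.T4Continuum.VariationalCovariantRegularityRho (hREG_rho)

variable {d : ℕ} (n L : ℕ) [NeZero n] [NeZero L] (M : Fin d → ℕ) [hM : ∀ μ, NeZero (M μ)]

/-- **THE SCALAR COVARIANT CANONICAL PAIR, ALL LEAVES DISCHARGED, UB⁺ RELATIVE TO A REFERENCE TRANSPORT `T₀`** (model level; only DATA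
hypotheses remain; conclusion = `scalar_pair_closed`'s `let`s at `w := w′`). [folklore] -/
theorem scalar_pair_closed_rel {Rc : Tor (fine n M) → Fin d → ℂ} {R' : Tor (fine L (fine n M)) → Fin d → ℂ}
    {T G : Tor (fine n M) → ℂ} {T' G' : Tor (fine L (fine n M)) → ℂ} {c : Tor M → ℂ} {c' : Tor (fine n M) → ℂ}
    -- P⁺ data (global frames) at both levels
    (hG : ∀ x, ‖G x‖ = 1) (hc : ∀ z, ‖c z‖ ≤ 1) {mG mB : ℝ}
    (hframe : ∀ x μ, ‖G (x + unitVec (fine n M) μ) - G x * Rc x μ‖ ≤ mG)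
    (hblock : ∀ z j, ‖G (bpt n M z j) - c z * T (bpt n M z j)‖ ≤ mB)
    (hsmall : 16 * (d : ℝ) ^ 2 * ((n : ℝ) * mG) ^ 2 + 4 * mB ^ 2 ≤ 1 / 2)
    (hG' : ∀ x, ‖G' x‖ = 1) (hc' : ∀ y, ‖c' y‖ ≤ 1) {mG' mB' : ℝ}
    (hframe' : ∀ x μ, ‖G' (x + unitVec (fine L (fine n M)) μ) - G' x * R' x μ‖ ≤ mG')
    (hblock' : ∀ y j, ‖G' (bpt L (fine n M) y j) - c' y * T' (bpt L (fine n M) y j)‖ ≤ mB')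
    (hsmall' : 16 * (d : ℝ) ^ 2 * ((L : ℝ) * mG') ^ 2 + 4 * mB' ^ 2 ≤ 1 / 2)
    -- FED⁺ data (one-block transport mismatch)
    (hR' : ∀ x μ, ‖R' x μ‖ ≤ 1) (hT1 : ∀ x, ‖T' x‖ = 1) {m : ℝ} (hm : 0 ≤ m)
    (hmis : ∀ y μ j, ‖mis L (fine n M) Rc R' T' y μ j‖ ≤ m) (habsorb : 512 * (d : ℝ) ^ 2 * ((n : ℝ) * m) ^ 2 ≤ 1 / 2)
    -- UB⁺ / REG⁺ data at level n: unit-modulus transports and phases, in-block defect `w`, plaquette defect `a`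
    (hT1c : ∀ x, ‖T x‖ = 1) (hRc1 : ∀ y μ, ‖Rc y μ‖ = 1)
    -- the REFERENCE transport, its in-block defect, the relative phase, the fictitious defect `w′`
    {T₀ : Tor (fine n M) → ℂ} (hT₀ : ∀ x, ‖T₀ x‖ = 1) {w : ℝ} (hw0 : 0 ≤ w)
    (hw : ∀ (y : Tor M) (j : Fin d → Fin n) (μ : Fin d), (j μ : ℕ) + 1 < n →
      ‖Rc (bpt n M y j) μ * (starRingEnd ℂ) (T₀ (bpt n M y j + unitVec (fine n M) μ)) * T₀ (bpt n M y j) - 1‖ ≤ w)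
    {γ : ℝ} (hγ : γ < 1) (hrel : ∀ x, ‖T x * (starRingEnd ℂ) (T₀ x) - 1‖ ≤ γ)
    {w' : ℝ} (hw'0 : 0 ≤ w') (hw' : (4 + n * w) / (1 - γ) - 1 ≤ n * w')
    {a : ℝ} (ha : 0 ≤ a)
    (hP : ∀ x μ ν, ‖Rc x μ * Rc (x + unitVec (fine n M) μ) ν - Rc x ν * Rc (x + unitVec (fine n M) ν) μ‖ ≤ a)
    -- ONE⁺ data: one-step in-block / crossing defects `m₁` of `(R′, T′, Rc)`
    {m₁ : ℝ} (hm₁ : 0 ≤ m₁)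
    (hin : ∀ (y : Tor (fine n M)) (j : Fin d → Fin L) (μ : Fin d), (j μ : ℕ) + 1 < L →
      ‖R' (bpt L (fine n M) y j) μ * (starRingEnd ℂ) (T' (bpt L (fine n M) y j + unitVec (fine L (fine n M)) μ)) * T' (bpt L (fine n M) y j) - 1‖
        ≤ m₁)
    (hcross : ∀ (y : Tor (fine n M)) (j : Fin d → Fin L) (μ : Fin d), (j μ : ℕ) + 1 = L →
      ‖R' (bpt L (fine n M) y j) μ * (starRingEnd ℂ) (T' (bpt L (fine n M) y j + unitVec (fine L (fine n M)) μ)) * T' (bpt L (fine n M) y j)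
        - Rc y μ‖ ≤ m₁)
    (μ : Tor M → ℂ) :
    let Λc : ℝ := 2 * d * (36 : ℝ) ^ d * ((1 + n * w') ^ 2 + 9)
    let CP : ℝ := 1088 * d + 128
    let CR : ℝ := 2 * Λc + 2 * d * (a * (n : ℝ) ^ 2) + (d : ℝ) ^ 2 * (a * (n : ℝ) ^ 2) ^ 2 * CP
    let ε₁ : ℝ := ((d : ℝ) / 4 + 1 / 2) * ((L : ℝ) / (n : ℝ) ^ 2)
    let δ' : ℝ := Real.sqrt (2 * d * (1 + (d : ℝ) ^ 2)) * ((n : ℝ) * L * m₁)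
    let Λ : ℝ := Λc + (ε₁ * CR + 2 * δ' * Real.sqrt ((1 + ε₁ * CR) * CP) + δ' ^ 2 * CP) * (Λc + 1)
    blockSpin (Qk n M T) (Sc n M Rc) μ ≤ blockSpin (Qk n M T ∘ Q1 n L M T') (Sf n L M R') μ
        + (2 * (Real.sqrt d * ((n : ℝ) * m)) * Real.sqrt (Λ * (CP * (Λ + 1)))
            + (Real.sqrt d * ((n : ℝ) * m)) ^ 2 * (CP * (Λ + 1))) * nsq μ ∧
      blockSpin (Qk n M T ∘ Q1 n L M T') (Sf n L M R') μ ≤ blockSpin (Qk n M T) (Sc n M Rc) μ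
        + (ε₁ * CR * (Λ + 1) + 2 * δ' * Real.sqrt ((Λ + ε₁ * CR * (Λ + 1)) * (CP * (Λ + 1)))
            + δ' ^ 2 * (CP * (Λ + 1))) * nsq μ := by
  intro Λc CP CR ε₁ δ' Λ
  have hn0 : (0 : ℝ) < n := by exact_mod_cast Nat.pos_of_ne_zero (NeZero.ne n)
  have hL1 : (1 : ℝ) ≤ L := by exact_mod_cast Nat.one_le_iff_ne_zero.mpr (NeZero.ne L)
  have hd : (0 : ℝ) ≤ d := Nat.cast_nonneg d
  have hΛc : 0 ≤ Λc := by positivity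
  have hCP : 0 ≤ CP := by positivity
  have hα : 0 ≤ a * (n : ℝ) ^ 2 := by positivity
  have hCR : 0 ≤ CR := by positivity
  have hε₁ : 0 ≤ ε₁ := by positivity
  have hδ' : 0 ≤ δ' := by positivity
  have hetil : 0 ≤ (ε₁ * CR + 2 * δ' * Real.sqrt ((1 + ε₁ * CR) * CP) + δ' ^ 2 * CP) * (Λc + 1) := by positivity
  have hΛ : 0 ≤ Λ := add_nonneg hΛc hetil
  have hRc : ∀ y μ, ‖Rc y μ‖ ≤ 1 := fun y μ => (hRc1 y μ).le
  have hT' : ∀ x, ‖T' x‖ ≤ 1 := fun x => (hT1 x).le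
  -- UB⁺ at level n RELATIVE TO THE REFERENCE `T₀` (this seat's R1, on leaf-04 gen 2's engine), in the capstone's letters
  have hUBc0 : ∀ μ : Tor M → ℂ, ∃ f, Qk n M T f = μ ∧ Sc n M Rc f ≤ Λc * nsq μ := by
    intro ν
    obtain ⟨f, hf, hb⟩ := exists_ub_scalarPair_rel_eff n M hT₀ hRc hw0 hw hγ hrel hw' ν
    exact ⟨f, hf, hb⟩
  -- P⁺ at both levels (road owner)
  have hPc : ∀ f, qW n M f ≤ CP * (Sc n M Rc f + nsq (Qk n M T f)) := fun f => qW_le_coarse n M hG hc hframe hblock hsmall f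
  have hPf : ∀ f', qV n L M f' ≤ CP * (Sf n L M R' f' + nsq (Qk n M T (Q1 n L M T' f'))) := fun f' =>
    qV_le_composite n L M hG hc hframe hblock hsmall hG' hc' hframe' hblock' hsmall' hR' hT' hm hmis habsorb f'
  -- ONE⁺ (leaf-01 gen 2), honest shape
  have hONE : ∀ f, blockSpin (Q1 n L M T') (Sf n L M R') f
      ≤ (Real.sqrt (Sc n M Rc f + ε₁ * rho n M Rc f) + δ' * Real.sqrt (qW n M f)) ^ 2 := fun f =>
    blockSpin_Q1_le n L M hT1 hRc1 hm₁ hin hcross f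
  -- REG⁺ (leaf-09 gen 3), for leaf ONE⁺'s ρ
  have hREG : ∀ (ν : Tor M → ℂ) f, Qk n M T f = ν → (∀ g, Qk n M T g = ν → Sc n M Rc f ≤ Sc n M Rc g) →
      rho n M Rc f ≤ CR * (Sc n M Rc f + nsq ν) := hREG_rho n M hT1c hRc1 ha hP hΛc hUBc0 hPc
  -- the structure hypotheses of the abstract lemmas
  have hnLd : (0 : ℝ) ≤ ((n : ℝ) * L) ^ d := by positivity
  have hnormW : ∀ f : Tor (fine n M) → ℂ, ‖f‖ ^ 2 ≤ ((n : ℝ) * L) ^ d * qW n M f := by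
    intro f
    refine (norm_sq_le_qW n M f).trans (mul_le_mul_of_nonneg_right ?_ (qW_nonneg n M f))
    rw [mul_pow]
    exact le_mul_of_one_le_right (by positivity) (one_le_pow₀ hL1)
  have hnormV : ∀ f' : Tor (fine L (fine n M)) → ℂ, ‖f'‖ ^ 2 ≤ ((n : ℝ) * L) ^ d * qV n L M f' := norm_sq_le_qV n L M
  -- UB⁺ one level up from the coarse one, sqrt world (leaf-01 gen 2's `fine_ub_of_coarse_sqrt`)
  have hUBf : ∀ ν : Tor M → ℂ, ∃ f', Qk n M T (Q1 n L M T' f') = ν ∧ Sf n L M R' f' ≤ Λ * nsq ν := by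
    intro ν
    exact fine_ub_of_coarse_sqrt (V := Tor (fine L (fine n M)) → ℂ) (W := Tor (fine n M) → ℂ) (Z := Tor M → ℂ)
      (Qk := Qk n M T) (Q₁ := Q1 n L M T') (Sc := Sc n M Rc) (Sf := Sf n L M R') (qW := qW n M) (qV := qV n L M) (qZ := nsq)
      (ρ := rho n M Rc) (continuous_Qc T) (continuous_Qc T') (continuous_sum_dirU Rc _) (continuous_sum_dirU R' _)
      (Q1_surjective n L M T' hT1) (Sc_nonneg n M Rc) (Sf_nonneg n L M R') (qW_nonneg n M) (fun μ => nsq_nonneg μ)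
      (rho_nonneg n M Rc) hnLd hnLd hΛc hCP hCR hε₁ hδ' hnormW hnormV hUBc0 hPc hPf hONE hREG ν
  -- the coarse UB⁺ with the common (larger) constant
  have hUBc : ∀ ν : Tor M → ℂ, ∃ f, Qk n M T f = ν ∧ Sc n M Rc f ≤ Λ * nsq ν := by
    intro ν
    obtain ⟨f, hf, hb⟩ := hUBc0 ν
    exact ⟨f, hf, hb.trans (mul_le_mul_of_nonneg_right (le_add_of_nonneg_right hetil) (nsq_nonneg ν))⟩
  exact scalar_pair_bracket_sqrt n L M hG hc hframe hblock hsmall hG' hc' hframe' hblock' hsmall' hR' hT' hT1 hm hmis habsorb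
    hΛ hCR hε₁ hδ' (rho_nonneg n M Rc) hUBc hUBf hONE hREG μ

end Summit.QuantumFields.BalabanUV.T4Continuum.VariationalCovariantScalarPairClosedRel

end
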